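import Summits.QuantumFields.YangMills.Theorems.SwapVirialDeficitBlowUpGnomonicStratumBFlat
import Summits.QuantumFields.YangMills.Theorems.SwapVirialDeficitBlowUpGnomonicSeamCommutatorFloor
import HarnessLib

/-!
# THE B-POINT SEAM FLOOR `[C₀, C₁]`: the axial direction `x₀′` of the `x`-letter is stiff at a stratum-B point (end hub `re a = 0`, `η_B = ((0,u),0,0,0)`)
# (free-hands support of ⟨stmt-QuantumFields-24197⟩ `SwapVirialDeficit.SwapGluedStiffness`; region (Rd) of LEAD g98 memo5 §2 — sequel of ✓`fibre_raySecond_ge_stratumB_eta`,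
# which has no `x₀′` term)

At a B point the slaved letter is `ŵ(0) = Ā·x̂_B·A = x̂_B*` (✓`conj_end_hub`), so the commutator path `f(s) = x̂(s)ŵ(s) − ŵ(s)x̂(s)` along the B-ray `η_B + s·ξ_B(d)` vanishes at
`s = 0` (`x̂x̂* = x̂*x̂`), and exactly as in ✓`fibre_raySecond_ge_seamComm` (✓`chartDeficit_ge_of_comm_far`, `μ = 0, ν = 1`; ✓`iteratedDeriv_two_norm_sq_of_zero`):
* `gnoLetter_transverse_axial_ray`, `inner_transverse_axial`, `norm_gnoLetter_transverse` — the `x`-letter along the B-ray is affine, the axial displacement is orthogonal to the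
  transverse base letter, `‖gnoLetter ε (0,u)‖ = √(1+|u|²)`; `hasDerivAt_xhatB_ray` (`x̂′(0) = X′ := (√(1+|u|²))⁻¹·(±(0,x₀′,0,0))`); `hasDerivAt_slaved_ray'` (product rule without
  the axial hypothesis: `ŵ′(0) = Ā·X′·A·ẑ(0) + Ā·x̂(0)·A·Z′`);
* ★★★ `fibre_raySecond_ge_stratumB_seam`: `‖X′·w₀ + x̂_B·W′ − W′·x̂_B − w₀·X′‖²/(900·L⁶) ≤ (d²/ds²)F̂(η_B + s·ξ_B(d))|₀`, `w₀ = Ā·x̂_B·A`, `W′ = Ā·X′·A + Ā·x̂_B·A·Z′`, `Z′ = (0,z′)`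
  — in coordinates (sequel) `‖…‖² ∝ x₀′²|u|²/(1+|u|²)² + (z′-coupling)`: the axial `x`-direction is stiff off the crossing `Σ = {u = 0}`.

HONEST LABEL: composition of landed inequalities + one-variable calculus; the (TS) regions, ⟨24197⟩ ∕ ⟨24194⟩ ∕ ⟨24497⟩ OPEN; own crux ⟨22884⟩ OPEN (blocked-on ⟨19935⟩); the
Yang–Mills mass gap is NOT proved; no summit is proved by a line.  THEOREMS ONLY (0 `def`, 0 `sorry`), standard axioms.
Width seat ym-line-sfw-p2-w3 g66 (cell ym-idea-1, free hands), `--supports stmt-QuantumFields-24197`.  References: [cite: Luscher1983, §2]; [folklore].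
-/

set_option autoImplicit false

noncomputable section

open MeasureTheory Quaternion
open scoped BigOperators Quaternion RealInnerProductSpace ContDiff
open Literature.MathematicalPhysics.QuantumFieldTheory hiding SU2
open Literature.MathematicalPhysics.QuantumLattice
open Literature.Analysis.Calculus (radialUnit radialUnit_def norm_radialUnit)

namespace Summit.QuantumFields.YangMills.Theorems.SwapVirialDeficit.BlowUpRing

open Summit.QuantumFields.YangMills.Theorems.FemtoTransferGap
open Summit.QuantumFields.YangMills.Theorems.FemtoTransferGap.TT
open Summit.QuantumFields.YangMills.Theorems.FemtoTransferGap.TwoLattice.Flat (fd)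
open Summit.QuantumFields.YangMills.Theorems.VirialFluxGap.RingDeficit
open Summit.QuantumFields.YangMills.Theorems.SwapVirialDeficit.SwapRing
open Summit.QuantumFields.YangMills.Theorems.SwapTwistDeficit.ToronLog (axisPoint)
open Summit.QuantumFields.YangMills.Theorems.SwapVirialDeficit.ZeroModeSigma (norm_axisUnit su2Quat_quatToSU2_eq_radialUnit axisUnit_axial)
open Summit.QuantumFields.YangMills.Theorems.SwapVirialDeficit.Gnomonic (normSq3 contDiff_gnoDeficit contDiff_radialUnit_gnoLetter)
open Summit.QuantumFields.YangMills.Theorems.QuantitativeLaplace (iteratedDeriv_two_ge_of_minorant)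
open Summit.QuantumFields.YangMills.Theorems.ToronValleyVolume.Lojasiewicz (fd_sq_eq_two_mul)

variable {L : ℕ} [NeZero L]

/-! ## §1 The `x`-letter along the B-ray -/

omit [NeZero L] in
/-- A transverse letter plus an axial displacement: `gnoLetter ε ((0,u₁,u₂) + s·(x₀′,0,0)) = gnoLetter ε (0,u₁,u₂) + s·(±(0,x₀′,0,0))`. [folklore] -/
theorem gnoLetter_transverse_axial_ray (ε : Bool) (u₁ u₂ x s : ℝ) :
    gnoLetter ε ((![0, u₁, u₂] : Fin 3 → ℝ) + s • ![x, 0, 0]) = gnoLetter ε ![0, u₁, u₂] + s • (gnoSign ε • (gnomonicQuat ![x, 0, 0]).im) := by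
  rw [gnoLetter_eq, gnoLetter_eq]
  ext <;> simp [gnomonicQuat]
  ring

omit [NeZero L] in
/-- The transverse base letter is orthogonal to the axial displacement. [folklore] -/
theorem inner_transverse_axial (ε : Bool) (u₁ u₂ x : ℝ) : ⟪gnoLetter ε ![0, u₁, u₂], gnoSign ε • (gnomonicQuat ![x, 0, 0]).im⟫ = 0 := by
  rw [Quaternion.inner_def, Quaternion.re_mul, gnoLetter_eq]
  simp [gnomonicQuat]

omit [NeZero L] in
/-- `‖gnoLetter ε (0,u₁,u₂)‖ = √(1 + (u₁² + u₂²))`. [folklore] -/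
theorem norm_gnoLetter_transverse (ε : Bool) (u₁ u₂ : ℝ) : ‖gnoLetter ε ![0, u₁, u₂]‖ = Real.sqrt (1 + (u₁ ^ 2 + u₂ ^ 2)) := by
  have h := norm_sq_gnoLetter ε ![0, u₁, u₂]
  have hn : Gnomonic.normSq3 ![0, u₁, u₂] = u₁ ^ 2 + u₂ ^ 2 := by
    simp [Gnomonic.normSq3, Fin.sum_univ_three]
  rw [hn] at h
  rw [← h, Real.sqrt_sq (norm_nonneg _)]

omit [NeZero L] in
/-- ★ The speed of `x̂` along the B-ray: `x̂′(0) = (√(1+|u|²))⁻¹·(±(0,x₀′,0,0))`. [folklore] -/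
theorem hasDerivAt_xhatB_ray (ε : Bool) (u₁ u₂ x : ℝ) :
    HasDerivAt (fun s : ℝ => radialUnit (gnoLetter ε ((![0, u₁, u₂] : Fin 3 → ℝ) + s • ![x, 0, 0])))
      ((Real.sqrt (1 + (u₁ ^ 2 + u₂ ^ 2)))⁻¹ • (gnoSign ε • (gnomonicQuat ![x, 0, 0]).im)) 0 := by
  have e : (fun s : ℝ => radialUnit (gnoLetter ε ((![0, u₁, u₂] : Fin 3 → ℝ) + s • ![x, 0, 0]))) =
      fun s : ℝ => radialUnit (gnoLetter ε ![0, u₁, u₂] + s • (gnoSign ε • (gnomonicQuat ![x, 0, 0]).im)) :=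
    funext fun s => by rw [gnoLetter_transverse_axial_ray]
  rw [e, ← norm_gnoLetter_transverse ε u₁ u₂]
  exact hasDerivAt_radialUnit_ray_orth (gnoLetter_ne_zero ε _) (inner_transverse_axial ε u₁ u₂ x)

omit [NeZero L] in
/-- ★ Product rule for the slaved letter without the axial hypothesis: `(Ā·x̂(s)·A·ẑ(s))′(0) = Ā·X′·A·ẑ(0) + Ā·x̂(0)·A·Z′`. [folklore] -/
theorem hasDerivAt_slaved_ray' {xh zh : ℝ → ℍ} {X' Z' A : ℍ} (hx : HasDerivAt xh X' 0) (hz : HasDerivAt zh Z' 0) :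
    HasDerivAt (fun s : ℝ => star A * xh s * A * zh s) (star A * X' * A * zh 0 + star A * xh 0 * A * Z') 0 := by
  have h1 : HasDerivAt (fun s : ℝ => star A * xh s * A) (star A * X' * A) 0 := by
    have := (hx.const_mul (star A)).mul_const A
    simpa [mul_assoc] using this
  exact h1.mul hz

/-! ## §2 The B-point seam floor -/

/-- ★★★ **THE B-POINT SEAM FLOOR** (end hub `a ≠ 0`, `re a = 0`; `ε_z = +`, followers `+`): with `x̂_B = ν(gnoLetter ε_x (0,u))`, `A = ν(axisPoint a)`, `w₀ = Ā·x̂_B·A`,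
`X′ = (√(1+|u|²))⁻¹·(gnoSign ε_x·(0,x₀′,0,0))`, `Z′ = (0,z′)`, `W′ = Ā·X′·A + Ā·x̂_B·A·Z′`:
`‖X′·w₀ + x̂_B·W′ − (W′·x̂_B + w₀·X′)‖²/(900·L⁶) ≤ (d²/ds²)F̂(η_B + s·ξ_B(d))|₀`. [cite: Luscher1983, §2] -/
theorem fibre_raySecond_ge_stratumB_seam {a : ℍ} (ha : a ≠ 0) (hre : a.re = 0) (ε : GnoSign L) (hz : ε.2.1 = true) (hε : ε.2.2 = fun _ => true) (u₁ u₂ : ℝ)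
    (d : ℝ × (Fin 3 → ℝ) × (Fin 3 → ℝ) × (Fol L → Fin 3 → ℝ)) :
    ‖((Real.sqrt (1 + (u₁ ^ 2 + u₂ ^ 2)))⁻¹ • (gnoSign ε.1.1 • (gnomonicQuat ![d.1, 0, 0]).im)) * (star (radialUnit (axisPoint a)) * radialUnit (gnoLetter ε.1.1 ![0, u₁, u₂]) * radialUnit (axisPoint a)) + radialUnit (gnoLetter ε.1.1 ![0, u₁, u₂]) * (star (radialUnit (axisPoint a)) * ((Real.sqrt (1 + (u₁ ^ 2 + u₂ ^ 2)))⁻¹ • (gnoSign ε.1.1 • (gnomonicQuat ![d.1, 0, 0]).im)) * radialUnit (axisPoint a) + star (radialUnit (axisPoint a)) * radialUnit (gnoLetter ε.1.1 ![0, u₁, u₂]) * radialUnit (axisPoint a) * (gnomonicQuat d.2.2.1).im) -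
        ((star (radialUnit (axisPoint a)) * ((Real.sqrt (1 + (u₁ ^ 2 + u₂ ^ 2)))⁻¹ • (gnoSign ε.1.1 • (gnomonicQuat ![d.1, 0, 0]).im)) * radialUnit (axisPoint a) + star (radialUnit (axisPoint a)) * radialUnit (gnoLetter ε.1.1 ![0, u₁, u₂]) * radialUnit (axisPoint a) * (gnomonicQuat d.2.2.1).im) * radialUnit (gnoLetter ε.1.1 ![0, u₁, u₂]) + (star (radialUnit (axisPoint a)) * radialUnit (gnoLetter ε.1.1 ![0, u₁, u₂]) * radialUnit (axisPoint a)) * ((Real.sqrt (1 + (u₁ ^ 2 + u₂ ^ 2)))⁻¹ • (gnoSign ε.1.1 • (gnomonicQuat ![d.1, 0, 0]).im)))‖ ^ 2 / (900 * (L : ℝ) ^ 6) ≤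
      iteratedDeriv 2 (fun s : ℝ => gnoDeficit (fun _ => false) (fun _ => 1) a ε
        (((((![0, u₁, u₂] : Fin 3 → ℝ), (0 : Fin 3 → ℝ)), ((0 : Fin 3 → ℝ), (0 : Fol L → Fin 3 → ℝ))) : GnoCoord L) +
          s • ((((![d.1, 0, 0] : Fin 3 → ℝ), d.2.1), (d.2.2.1, d.2.2.2)) : GnoCoord L))) 0 := by
  have hL : (0 : ℝ) < L := by exact_mod_cast NeZero.pos L
  -- names
  set A : ℍ := radialUnit (axisPoint a) with hA
  set X' : ℍ := ((Real.sqrt (1 + (u₁ ^ 2 + u₂ ^ 2)))⁻¹ • (gnoSign ε.1.1 • (gnomonicQuat ![d.1, 0, 0]).im)) with hX'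
  set Z' : ℍ := (gnomonicQuat d.2.2.1).im with hZ'
  set η : ℝ → GnoCoord L := fun s =>
    ((((![0, u₁, u₂] : Fin 3 → ℝ), (0 : Fin 3 → ℝ)), ((0 : Fin 3 → ℝ), (0 : Fol L → Fin 3 → ℝ))) : GnoCoord L) +
      s • ((((![d.1, 0, 0] : Fin 3 → ℝ), d.2.1), (d.2.2.1, d.2.2.2)) : GnoCoord L) with hη
  set xh : ℝ → ℍ := fun s => su2Quat (quatToSU2 (gnoLetter ε.1.1 ((![0, u₁, u₂] : Fin 3 → ℝ) + s • ![d.1, 0, 0]))) with hxh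
  set zh : ℝ → ℍ := fun s => su2Quat (quatToSU2 (gnoLetter true (s • d.2.2.1))) with hzh
  set wh : ℝ → ℍ := fun s => star A * xh s * A * zh s with hwh
  set f : ℝ → ℍ := fun s => xh s * wh s - wh s * xh s with hf
  set φ : ℝ → ℝ := fun s => gnoDeficit (fun _ => false) (fun _ => 1) a ε (η s) with hφ
  have hA1 : ‖A‖ = 1 := norm_axisUnit ha
  -- the letters of the ray point
  have hlet : ∀ s, (η s).1.1 = (![0, u₁, u₂] : Fin 3 → ℝ) + s • ![d.1, 0, 0] ∧ (η s).2.1 = s • d.2.2.1 := fun s =>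
    ⟨rfl, by show (0 : Fin 3 → ℝ) + s • d.2.2.1 = s • d.2.2.1; rw [zero_add]⟩
  have hxh_rad : ∀ s, xh s = radialUnit (gnoLetter ε.1.1 ((![0, u₁, u₂] : Fin 3 → ℝ) + s • ![d.1, 0, 0])) := fun s =>
    su2Quat_quatToSU2_eq_radialUnit (gnoLetter_ne_zero _ _)
  have hzh_rad : ∀ s, zh s = radialUnit (gnoLetter true (s • d.2.2.1)) := fun s => su2Quat_quatToSU2_eq_radialUnit (gnoLetter_ne_zero _ _)
  -- leaders `C₀`, `C₁` along the ray read through `su2Quat`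
  have hC0 : ∀ s, su2Quat ((blowUpPoint (L := L) 1 (gnomonicPoint a ε (η s))).1 0) = xh s := fun s => by
    rw [su2Quat_gnoLeader_zero, (hlet s).1, hxh_rad]
  have hC1 : ∀ s, su2Quat ((blowUpPoint (L := L) 1 (gnomonicPoint a ε (η s))).1 1) = wh s := fun s => by
    rw [su2Quat_gnoLeader_one ha, (hlet s).1, (hlet s).2, hz]
    show _ = star A * xh s * A * zh s
    rw [hxh_rad, hzh_rad]
  -- the minorant `γ(s) = ‖f s‖²/(1800 L⁶) ≤ φ s`
  have hγle : ∀ s, ‖f s‖ ^ 2 / (1800 * (L : ℝ) ^ 6) ≤ φ s := by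
    intro s
    set q := blowUpPoint (L := L) 1 (gnomonicPoint a ε (η s)) with hq
    have h := chartDeficit_ge_of_comm_far (L := L) q 0 1 (frobNorm_nonneg _) le_rfl
    have e0 : (Fin.castSucc (0 : Fin 3) : Fin 4) = 0 := rfl
    have e1 : (Fin.castSucc (1 : Fin 3) : Fin 4) = 1 := rfl
    rw [e0, e1] at h
    have hfd : frobNorm (((q.1 0 * q.1 1 : SU2) : Matrix (Fin 2) (Fin 2) ℂ) - ((q.1 1 * q.1 0 : SU2) : Matrix (Fin 2) (Fin 2) ℂ)) = fd (q.1 0 * q.1 1) (q.1 1 * q.1 0) := by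
      simp only [fd]
    have hsq : frobNorm (((q.1 0 * q.1 1 : SU2) : Matrix (Fin 2) (Fin 2) ℂ) - ((q.1 1 * q.1 0 : SU2) : Matrix (Fin 2) (Fin 2) ℂ)) ^ 2 = 2 * ‖f s‖ ^ 2 := by
      rw [hfd, fd_sq_eq_two_mul, Balaban1983to89.T4HaarSU2Translate.su2Quat_mul, Balaban1983to89.T4HaarSU2Translate.su2Quat_mul, hq, hC0, hC1]
    rw [hsq] at h
    show ‖f s‖ ^ 2 / (1800 * (L : ℝ) ^ 6) ≤ gnoDeficit (fun _ => false) (fun _ => 1) a ε (η s)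
    unfold gnoDeficit
    calc ‖f s‖ ^ 2 / (1800 * (L : ℝ) ^ 6) = 2 * ‖f s‖ ^ 2 / (3600 * (L : ℝ) ^ 6) := by field_simp; ring
      _ ≤ _ := h
  -- smoothness
  have hxhd : ContDiff ℝ ∞ xh :=
    (contDiff_radialUnit_gnoLetter (n := ⊤) ε.1.1).comp (contDiff_const.add (contDiff_id.smul contDiff_const))
  have hzhd : ContDiff ℝ ∞ zh := (contDiff_radialUnit_gnoLetter (n := ⊤) true).comp (contDiff_id.smul contDiff_const)
  have hwhd : ContDiff ℝ ∞ wh := ((contDiff_const.mul hxhd).mul contDiff_const).mul hzhd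
  have hfd : ContDiff ℝ ∞ f := (hxhd.mul hwhd).sub (hwhd.mul hxhd)
  have hγd : ContDiff ℝ ∞ (fun s => ‖f s‖ ^ 2 / (1800 * (L : ℝ) ^ 6)) := (hfd.norm_sq ℝ).div_const _
  have hφd : ContDiff ℝ ∞ φ := contDiff_gnoDeficit_ray (L := L) (fun _ => false) (fun _ => 1) ha ε _ _ (n := ⊤)
  -- values at `0`
  have hx0 : xh 0 = radialUnit (gnoLetter ε.1.1 ![0, u₁, u₂]) := by rw [hxh_rad]; simp
  have hz0 : zh 0 = 1 := by rw [hzh_rad, zero_smul, gnoLetter_true_zero, radialUnit_one_quat]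
  have hw0 : wh 0 = star A * xh 0 * A := by simp only [hwh, hz0, mul_one]
  -- `ŵ(0) = x̂_B*`, hence `f 0 = 0`
  have hAc := end_hub_components ha hre
  rw [← hA] at hAc
  have hxI : (xh 0).imI = 0 := by
    rw [hx0, radialUnit_def, Quaternion.imI_smul, gnoLetter_eq]; simp [gnomonicQuat]
  have hconj := conj_end_hub hAc (xh 0)
  have hstar : star A * xh 0 * A = star (xh 0) := by
    ext
    · rw [hconj.1, Quaternion.re_star]
    · rw [hconj.2.1, Quaternion.imI_star, hxI, neg_zero]
    · rw [hconj.2.2.1, Quaternion.imJ_star]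
    · rw [hconj.2.2.2, Quaternion.imK_star]
  have hf0 : f 0 = 0 := by
    simp only [hf, hw0, hstar]
    rw [Quaternion.self_mul_star, Quaternion.star_mul_self, sub_self]
  have hφ0 : φ 0 = 0 := by
    simp only [hφ, hη, zero_smul, add_zero]
    exact gnoDeficit_stratumB_eq_zero ha hre ε hz hε u₁ u₂
  -- speeds at `0`
  have hxs : HasDerivAt xh X' 0 := by
    have h := hasDerivAt_xhatB_ray ε.1.1 u₁ u₂ d.1
    have e : xh = fun s => radialUnit (gnoLetter ε.1.1 ((![0, u₁, u₂] : Fin 3 → ℝ) + s • ![d.1, 0, 0])) := funext hxh_rad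
    rw [e]; exact h
  have hzs : HasDerivAt zh Z' 0 := by
    have h := hasDerivAt_zhat_ray (d.2.2.1)
    have e : zh = fun s => radialUnit (gnoLetter true (s • d.2.2.1)) := funext hzh_rad
    rw [e]; exact h
  have hws : HasDerivAt wh (star A * X' * A * zh 0 + star A * xh 0 * A * Z') 0 := hasDerivAt_slaved_ray' hxs hzs
  rw [hz0, mul_one] at hws
  have hfs : HasDerivAt f (X' * wh 0 + xh 0 * (star A * X' * A + star A * xh 0 * A * Z') -
      ((star A * X' * A + star A * xh 0 * A * Z') * xh 0 + wh 0 * X')) 0 :=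
    (hxs.mul hws).sub (hws.mul hxs)
  have hderiv : deriv f 0 = X' * (star A * xh 0 * A) + xh 0 * (star A * X' * A + star A * xh 0 * A * Z') -
      ((star A * X' * A + star A * xh 0 * A * Z') * xh 0 + star A * xh 0 * A * X') := by
    rw [hfs.deriv, hw0]
  -- second derivative of the minorant
  have hγ2 : iteratedDeriv 2 (fun s => ‖f s‖ ^ 2 / (1800 * (L : ℝ) ^ 6)) 0 = 2 * ‖deriv f 0‖ ^ 2 / (1800 * (L : ℝ) ^ 6) := by
    have e : (fun s => ‖f s‖ ^ 2 / (1800 * (L : ℝ) ^ 6)) = fun s => (1800 * (L : ℝ) ^ 6)⁻¹ * ‖f s‖ ^ 2 := by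
      funext s; rw [div_eq_inv_mul]
    rw [e, iteratedDeriv_const_mul _ ((hfd.norm_sq ℝ).contDiffAt.of_le (by norm_cast)),
      iteratedDeriv_two_norm_sq_of_zero (hfd.of_le (by norm_cast)) hf0]
    rw [div_eq_inv_mul]
  -- the minorant comparison
  have key := iteratedDeriv_two_ge_of_minorant hφd hγd hγle (by
    show ‖f 0‖ ^ 2 / (1800 * (L : ℝ) ^ 6) = φ 0
    rw [hf0, hφ0, norm_zero]; simp)
  rw [hγ2, hderiv, hx0] at key
  calc _ = 2 * ‖X' * (star A * radialUnit (gnoLetter ε.1.1 ![0, u₁, u₂]) * A) +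
        radialUnit (gnoLetter ε.1.1 ![0, u₁, u₂]) * (star A * X' * A + star A * radialUnit (gnoLetter ε.1.1 ![0, u₁, u₂]) * A * Z') -
        ((star A * X' * A + star A * radialUnit (gnoLetter ε.1.1 ![0, u₁, u₂]) * A * Z') * radialUnit (gnoLetter ε.1.1 ![0, u₁, u₂]) +
          star A * radialUnit (gnoLetter ε.1.1 ![0, u₁, u₂]) * A * X')‖ ^ 2 / (1800 * (L : ℝ) ^ 6) := by
        field_simp; ring
    _ ≤ _ := key

end Summit.QuantumFields.YangMills.Theorems.SwapVirialDeficit.BlowUpRing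

end
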